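import Summits.ABC.IUTFork.Repair.RHRound4ConstraintRequirementsCProofs
import Literature.IUT.LogVolume.TensorPacketMeasure
import HarnessLib

/-!
# R-H ROUND 4, census O-15 (R-V6-1), row R4V6TRANS: the EMPTY-PACKET FACES — `V6_R1_orbitTransitivity` and `V6_R1_orbitModuleRigidity`
# are FALSE AS TYPED at `I = ∅`, and the surviving displayed hypothesis of both R-V6-1 kills is EXACTLY `Nonempty I`

abc-iut cell, rung LADDER-ABC:A2.RESCUE.H; seat abc-iut-L5-t11 (GEN 19; KEY `wake/KEY-abc-iut-L5-t11-R4V6TRANS.md` 44eaf999d242478a, abc-iut-rh-lead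
g6 R92 / R95 ADDENDUM).  PROOF-ONLY companion (0 def / 0 instance / 0 notation / 0 new `Prop` fact) of abc-iut-L5-t8's ★ p544620
`Repair/RHRound4ConstraintRequirementsC.lean` (defs `V6_R1_orbitTransitivity`, `V6_R1_orbitModuleRigidity`, …) and of abc-iut-L5-t8 g12's ★ p546164
`Repair/RHRound4ConstraintRequirementsCProofs.lean` — THE FILE OF RECORD FOR THE NONEMPTY CASE (`V6_R1_orbitTransitivity_holds`,
`V6_R1_orbitModuleRigidity_holds`, `not_finerStableFiltration`, `not_finerStableSubgroupFiltration`, all under `[Nonempty I]`; imported and cited BY NAME,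
nothing re-proved here — this seat's parallel §1 re-proof was withdrawn on the gate's `dedup.landed`, R95).

THE TYPED CARRIER (read first-hand, `Literature/IUT/LogVolume/TensorPacketRing.lean`): `V = PacketAlgebra p k = ⨂[ℚ_p] k_i`, `L = logPacket p k`
= the additive closure of the pure tensors `⊗ z_i`, `z_i ∈ log_p(R_i^×)`; `p·L = ppow p k 1 • L`; `IsLogPacketAut φ ⟺ φ(L) = L`, i.e. ALL `ℚ_p`-linear
automorphisms of `V` mapping `L` onto itself = the tree's (Ind2) group `indTwo` (`TensorPacketShell`).  [IUTchIV] Prop. 1.1/1.2 (kurims p. 9–11)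
carry the standing hypothesis «`I` a finite set of cardinality `≥ 2`»; the R-V6-1 defs carry no cardinality binder.
[cite: Mochizuki2012, IUTchIV Prop. 1.2 p. 10] (claim key; nothing of [IUTchI–IV] is asserted here).

WHAT THIS FILE PROVES (elementary, over OUR typed carrier):
* §1 the EMPTY-PACKET FACES (`[IsEmpty I]`, no ultrametric/proper binder): every pure tensor is `1` (`purePacket_eq_one_of_isEmpty`), so
  `L = ℤ·1 ⊂ V = ℚ_p` (`logPacket_eq_zmultiples_one_of_isEmpty` — NOT a `ℤ_p`-module), `n·1 ∈ p·L ⟺ p ∣ n` (`zsmul_one_mem_pMul_iff_of_isEmpty`), a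
  log-packet automorphism maps `1 ↦ ±1` (`apply_one_eq_of_isLogPacketAut_of_isEmpty`); hence **`not_orbitTransitivity_of_isEmpty : ¬ V6_R1_orbitTransitivity p k`**
  (witness `x = 1`, `y = (1+p)·1 ∈ L ∖ p·L`, not exchanged) and **`not_orbitModuleRigidity_of_isEmpty : ¬ V6_R1_orbitModuleRigidity p k`**
  (witness `M = ℤ·(1+p)·1`, stable under `±1`, meets `L ∖ p·L`, misses `1`) — the sentence abc-iut-L5-t8's docstring states in prose («for `I = ∅` …
  transitivity genuinely fails, e.g. `1 ↦ 1 + p`»), now in the kernel;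
* §2 the SYNTHESIS with ★ p546164: **`orbitTransitivity_iff_nonempty : V6_R1_orbitTransitivity p k ↔ Nonempty I`** and
  **`orbitModuleRigidity_iff_nonempty : V6_R1_orbitModuleRigidity p k ↔ Nonempty I`** (V6-section binders) — the displayed hypothesis of the two R-V6-1
  kills survives EXACTLY as `Nonempty I` (discharged by any actual packet; print: `|I| ≥ 2`), no more and no less.
Census O-15 (proposed wording, desk folds): ‹R-V6-1 KILLED BY NAME in BOTH readings UNCONDITIONALLY on every nonempty packet (★ p546164); at the degenerate
empty packet the obstruction and its mechanism are FALSE as typed (this file) — a typing boundary of OUR carrier (no `|I| ≥ 1` binder), not a door›.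
HONEST FRAMING / GUARDS: KILLED = as typed at OUR interface (a hypothetical theory dropping the `⌊·/e⌋` rounding), ≠ refuted in print; refuted-as-typed at
a degenerate packet ≠ refuted in print; the requirement `Prop`s stay claim-tagged hypotheses in OUR currency, never Literature facts (FROZEN FACT-LIST
f75a60bac22efdb6; 0 new Literature Props); located ≠ adjudicated; typed ≠ proved (except the theorems below); no side on [IUTchIII] Cor. 3.12 /
[IUTchIV] Prop. 1.2 / Thm. 1.10 or on any author (D-0045); nothing here asserts that abc is proved or refuted. [claim: Mochizuki2012, status: disputed]
for every IUT locution.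
-/

noncomputable section

namespace Summit.ABC.IUTFork.Repair.RH.Round4ConstraintV6Transitivity

open Summit.ABC.IUTFork.Repair.RH.Round4ConstraintRequirements Literature.IUT.LogVolume
open scoped Pointwise

variable (p : ℕ) [Fact p.Prime]
variable {I : Type} [Fintype I]
variable (k : I → Type) [∀ i, NontriviallyNormedField (k i)] [∀ i, NormedAlgebra ℚ_[p] (k i)]
variable [∀ i, IsUltrametricDist (k i)] [∀ i, ProperSpace (k i)]

/-! ## §1. The empty packet `I = ∅`: `V = ℚ_p`, `L = ℤ·1`, and `V6_R1_orbitTransitivity` is FALSE as typed -/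

section EmptyPacket

variable [IsEmpty I]

omit [Fintype I] [∀ i, IsUltrametricDist (k i)] [∀ i, ProperSpace (k i)] in
/-- At the empty packet every pure tensor is the unit: `⊗_{i ∈ ∅} z_i = 1`. [cite: Mochizuki2012, IUTchIV Prop. 1.2 p. 10] -/
theorem purePacket_eq_one_of_isEmpty (z : Π i, k i) : purePacket p k z = 1 := by
  rw [Subsingleton.elim z 1, purePacket_one]

omit [Fintype I] [∀ i, IsUltrametricDist (k i)] [∀ i, ProperSpace (k i)] in
/-- At the empty packet `log_p(R_I^×) = ℤ·1` — the additive closure of the single pure tensor `1`; in particular it is NOT a `ℤ_p`-submodule of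
`V = ℚ_p`. [cite: Mochizuki2012, IUTchIV Prop. 1.2 p. 10] -/
theorem logPacket_eq_zmultiples_one_of_isEmpty : logPacket p k = AddSubgroup.zmultiples (1 : PacketAlgebra p k) := by
  rw [AddSubgroup.zmultiples_eq_closure]
  unfold logPacket
  congr 1
  ext t
  simp only [Set.mem_setOf_eq, Set.mem_singleton_iff]
  constructor
  · rintro ⟨z, -, rfl⟩
    exact purePacket_eq_one_of_isEmpty p k z
  · rintro rfl
    exact ⟨1, fun i => isEmptyElim i, (purePacket_one p k).symm⟩

omit [Fintype I] [∀ i, IsUltrametricDist (k i)] [∀ i, ProperSpace (k i)] in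
/-- At the empty packet the elements of `L` are the `n·1`, `n ∈ ℤ`. [cite: Mochizuki2012, IUTchIV Prop. 1.2 p. 10] -/
theorem mem_logPacket_iff_of_isEmpty (t : PacketAlgebra p k) : t ∈ logPacket p k ↔ ∃ n : ℤ, n • (1 : PacketAlgebra p k) = t := by
  rw [logPacket_eq_zmultiples_one_of_isEmpty, AddSubgroup.mem_zmultiples_iff]

omit [∀ i, IsUltrametricDist (k i)] [∀ i, ProperSpace (k i)] [IsEmpty I] in
/-- `n·1 = m·1` in `V` forces `n = m` (`V ≠ 0` is a `ℚ_p`-vector space). [cite: Mochizuki2012, IUTchIV Prop. 1.2 p. 10] -/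
theorem zsmul_one_injective {n m : ℤ} (h : n • (1 : PacketAlgebra p k) = m • (1 : PacketAlgebra p k)) : n = m := by
  haveI := nontrivial_packetAlgebra' p k
  rw [← Int.cast_smul_eq_zsmul ℚ_[p] n, ← Int.cast_smul_eq_zsmul ℚ_[p] m] at h
  have h1 : (1 : PacketAlgebra p k) ≠ 0 := one_ne_zero
  exact Int.cast_injective (smul_left_injective ℚ_[p] h1 h)

omit [∀ i, IsUltrametricDist (k i)] [∀ i, ProperSpace (k i)] in
/-- At the empty packet, `n·1 ∈ p·L` iff `p ∣ n`-witnessed: membership unfolds to `n = p·m`. [cite: Mochizuki2012, IUTchIV Prop. 1.2 p. 10] -/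
theorem zsmul_one_mem_pMul_iff_of_isEmpty (n : ℤ) :
    n • (1 : PacketAlgebra p k) ∈ ppow p k 1 • (logPacket p k : Set (PacketAlgebra p k)) ↔ ∃ m : ℤ, n = p * m := by
  rw [ppow_one_smul_logPacket, Set.mem_smul_set]
  constructor
  · rintro ⟨t, ht, hnt⟩
    obtain ⟨m, rfl⟩ := (mem_logPacket_iff_of_isEmpty p k t).mp ht
    refine ⟨m, zsmul_one_injective p k ?_⟩
    rw [← hnt, ← Int.cast_smul_eq_zsmul ℚ_[p] m, smul_smul, ← Int.cast_smul_eq_zsmul ℚ_[p] ((p : ℤ) * m)]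
    push_cast
    rfl
  · rintro ⟨m, rfl⟩
    refine ⟨m • (1 : PacketAlgebra p k), (mem_logPacket_iff_of_isEmpty p k _).mpr ⟨m, rfl⟩, ?_⟩
    rw [← Int.cast_smul_eq_zsmul ℚ_[p] m, smul_smul, ← Int.cast_smul_eq_zsmul ℚ_[p] ((p : ℤ) * m)]
    push_cast
    rfl

omit [∀ i, IsUltrametricDist (k i)] [∀ i, ProperSpace (k i)] in
/-- At the empty packet a log-packet automorphism maps `1` to `±1` (it induces an automorphism of `L = ℤ·1 ≅ ℤ`).
[cite: Mochizuki2012, IUTchIV Prop. 1.2 p. 10] -/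
theorem apply_one_eq_of_isLogPacketAut_of_isEmpty {φ : PacketAlgebra p k ≃ₗ[ℚ_[p]] PacketAlgebra p k} (hφ : IsLogPacketAut p k φ) :
    φ 1 = 1 ∨ φ 1 = -1 := by
  have h1L : (1 : PacketAlgebra p k) ∈ (logPacket p k : Set (PacketAlgebra p k)) :=
    (mem_logPacket_iff_of_isEmpty p k 1).mpr ⟨1, one_zsmul _⟩
  -- `φ 1 ∈ L`: `φ 1 = m·1`
  have hφ1 : φ 1 ∈ (logPacket p k : Set (PacketAlgebra p k)) := by
    rw [← hφ]
    exact Set.mem_image_of_mem _ h1L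
  obtain ⟨m, hm⟩ := (mem_logPacket_iff_of_isEmpty p k _).mp hφ1
  -- `1 ∈ φ(L)`: `1 = φ (n·1) = (n m)·1`
  have h1 : (1 : PacketAlgebra p k) ∈ φ '' (logPacket p k : Set (PacketAlgebra p k)) := by
    rw [hφ]
    exact h1L
  obtain ⟨t, ht, hφt⟩ := h1
  obtain ⟨n, rfl⟩ := (mem_logPacket_iff_of_isEmpty p k t).mp ht
  have hnm : n * m = 1 := by
    apply zsmul_one_injective p k
    rw [mul_zsmul, hm, ← map_zsmul, hφt, one_zsmul]
  rcases Int.eq_one_or_neg_one_of_mul_eq_one' hnm with ⟨-, rfl⟩ | ⟨-, rfl⟩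
  · left
    rw [← hm, one_zsmul]
  · right
    rw [← hm, neg_one_zsmul]

omit [∀ i, IsUltrametricDist (k i)] [∀ i, ProperSpace (k i)] in
/-- **THE EMPTY-PACKET FACE: `V6_R1_orbitTransitivity p k` is FALSE AS TYPED at `I = ∅`.**  Witness: `x = 1` and `y = (1+p)·1` both lie in
`L ∖ p·L` (`L = ℤ·1`, `p ∤ 1`, `p ∤ 1 + p`), while every log-packet automorphism sends `1 ↦ ±1 ≠ (1+p)·1`.  So the displayed hypothesis of
abc-iut-L5-t8's two kills is NOT a theorem of every typed packet: the R-V6-1 defs carry no `|I| ≥ 1` binder (print's Prop. 1.1/1.2: `|I| ≥ 2`), and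
the surviving hypothesis is exactly `Nonempty I` (§1).  OUR bookkeeping about OUR carrier; refuted-as-typed at a degenerate packet ≠ refuted in
print. [cite: Mochizuki2012, IUTchIV Prop. 1.2 p. 10] [claim: Mochizuki2012, status: disputed] -/
theorem not_orbitTransitivity_of_isEmpty : ¬ V6_R1_orbitTransitivity p k := by
  intro hT
  have hp : p.Prime := Fact.out
  have hxL : (1 : PacketAlgebra p k) ∈ logPacket p k := (mem_logPacket_iff_of_isEmpty p k 1).mpr ⟨1, one_zsmul _⟩
  have hyL : ((1 + p : ℤ)) • (1 : PacketAlgebra p k) ∈ logPacket p k := (mem_logPacket_iff_of_isEmpty p k _).mpr ⟨_, rfl⟩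
  have hxp : (1 : PacketAlgebra p k) ∉ ppow p k 1 • (logPacket p k : Set (PacketAlgebra p k)) := by
    rw [← one_zsmul (1 : PacketAlgebra p k), zsmul_one_mem_pMul_iff_of_isEmpty]
    rintro ⟨m, hm⟩
    have hdvd : (p : ℤ) ∣ 1 := ⟨m, hm⟩
    exact hp.not_dvd_one (Int.natCast_dvd_natCast.mp hdvd)
  have hyp : ((1 + p : ℤ)) • (1 : PacketAlgebra p k) ∉ ppow p k 1 • (logPacket p k : Set (PacketAlgebra p k)) := by
    rw [zsmul_one_mem_pMul_iff_of_isEmpty]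
    rintro ⟨m, hm⟩
    have hdvd : (p : ℤ) ∣ 1 + p := ⟨m, hm⟩
    have hdvd' : (p : ℤ) ∣ 1 := (dvd_add_left (dvd_refl (p : ℤ))).mp hdvd
    exact hp.not_dvd_one (Int.natCast_dvd_natCast.mp hdvd')
  obtain ⟨φ, hφ, hφx⟩ := hT 1 (((1 + p : ℤ)) • (1 : PacketAlgebra p k)) hxL hxp hyL hyp
  rcases apply_one_eq_of_isLogPacketAut_of_isEmpty p k hφ with h | h
  · rw [h, ← one_zsmul (1 : PacketAlgebra p k), ← mul_zsmul, mul_one] at hφx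
    have := zsmul_one_injective p k hφx
    have : (p : ℤ) = 0 := by omega
    exact hp.ne_zero (by exact_mod_cast this)
  · rw [h, ← neg_one_zsmul (1 : PacketAlgebra p k)] at hφx
    have := zsmul_one_injective p k hφx
    have : (p : ℤ) = -2 := by omega
    have h0 : (0 : ℤ) ≤ (p : ℤ) := Int.natCast_nonneg p
    omega

omit [∀ i, IsUltrametricDist (k i)] [∀ i, ProperSpace (k i)] in
/-- … and the typed obstruction `V6_R1_orbitModuleRigidity p k` is FALSE at the empty packet too: `M = (1+p)ℤ·1` is an additive subgroup of `V`
stable under every log-packet automorphism (`±1`), it meets `L ∖ p·L` at `(1+p)·1`, yet `1 ∉ M`.  OUR bookkeeping; refuted-as-typed at a degenerate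
packet ≠ refuted in print. [cite: Mochizuki2012, IUTchIV Prop. 1.2 p. 10] [claim: Mochizuki2012, status: disputed] -/
theorem not_orbitModuleRigidity_of_isEmpty : ¬ V6_R1_orbitModuleRigidity p k := by
  intro hR
  have hp : p.Prime := Fact.out
  let y : PacketAlgebra p k := ((1 + p : ℤ)) • (1 : PacketAlgebra p k)
  have hyL : y ∈ logPacket p k := (mem_logPacket_iff_of_isEmpty p k _).mpr ⟨_, rfl⟩
  have hyp : y ∉ ppow p k 1 • (logPacket p k : Set (PacketAlgebra p k)) := by
    show ((1 + p : ℤ)) • (1 : PacketAlgebra p k) ∉ _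
    rw [zsmul_one_mem_pMul_iff_of_isEmpty]
    rintro ⟨m, hm⟩
    have hdvd : (p : ℤ) ∣ 1 + p := ⟨m, hm⟩
    have hdvd' : (p : ℤ) ∣ 1 := (dvd_add_left (dvd_refl (p : ℤ))).mp hdvd
    exact hp.not_dvd_one (Int.natCast_dvd_natCast.mp hdvd')
  -- every log-packet automorphism is `±1` on `ℤ·1`, so it stabilises `M = ℤ·y`
  have hstab : ∀ φ : PacketAlgebra p k ≃ₗ[ℚ_[p]] PacketAlgebra p k, IsLogPacketAut p k φ →
      φ '' (AddSubgroup.zmultiples y : Set (PacketAlgebra p k)) = AddSubgroup.zmultiples y := by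
    intro φ hφ
    -- `φ (n·y) = ε n · y` with `ε = ±1`
    have key : ∀ n : ℤ, ∃ n' : ℤ, φ (n • y) = n' • y ∧ φ (n' • y) = n • y := by
      intro n
      rcases apply_one_eq_of_isLogPacketAut_of_isEmpty p k hφ with h | h
      · refine ⟨n, ?_, ?_⟩ <;>
        · show φ (n • (((1 + p : ℤ)) • (1 : PacketAlgebra p k))) = n • (((1 + p : ℤ)) • (1 : PacketAlgebra p k))
          rw [map_zsmul, map_zsmul, h]
      · refine ⟨-n, ?_, ?_⟩
        · show φ (n • (((1 + p : ℤ)) • (1 : PacketAlgebra p k))) = (-n) • (((1 + p : ℤ)) • (1 : PacketAlgebra p k))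
          rw [map_zsmul, map_zsmul, h, zsmul_neg, zsmul_neg, ← neg_zsmul]
        · show φ ((-n) • (((1 + p : ℤ)) • (1 : PacketAlgebra p k))) = n • (((1 + p : ℤ)) • (1 : PacketAlgebra p k))
          rw [map_zsmul, map_zsmul, h, zsmul_neg, zsmul_neg, ← neg_zsmul, neg_neg]
    ext z
    simp only [Set.mem_image, SetLike.mem_coe, AddSubgroup.mem_zmultiples_iff]
    constructor
    · rintro ⟨t, ⟨n, rfl⟩, rfl⟩
      obtain ⟨n', h1, -⟩ := key n
      exact ⟨n', h1.symm⟩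
    · rintro ⟨n, rfl⟩
      obtain ⟨n', -, h2⟩ := key n
      exact ⟨n' • y, ⟨n', rfl⟩, h2⟩
  have hsub := hR (AddSubgroup.zmultiples y) hstab ⟨y, AddSubgroup.mem_zmultiples y, hyL, hyp⟩
  have h1 : (1 : PacketAlgebra p k) ∈ AddSubgroup.zmultiples y :=
    hsub ((mem_logPacket_iff_of_isEmpty p k 1).mpr ⟨1, one_zsmul _⟩)
  obtain ⟨n, hn⟩ := AddSubgroup.mem_zmultiples_iff.mp h1
  have hn' : (n * (1 + p)) • (1 : PacketAlgebra p k) = (1 : ℤ) • (1 : PacketAlgebra p k) := by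
    rw [mul_zsmul, one_zsmul]
    exact hn
  have hnm := zsmul_one_injective p k hn'
  rcases Int.eq_one_or_neg_one_of_mul_eq_one' hnm with ⟨-, h⟩ | ⟨-, h⟩
  · have : (p : ℤ) = 0 := by omega
    exact hp.ne_zero (by exact_mod_cast this)
  · have h0 : (0 : ℤ) ≤ (p : ℤ) := Int.natCast_nonneg p
    omega

end EmptyPacket


/-! ## §2. Synthesis with ★ p546164: the surviving displayed hypothesis is EXACTLY `Nonempty I` -/

section Synthesis

variable [DecidableEq I]

/-- **`V6_R1_orbitTransitivity p k ⟺ I ≠ ∅`** (V6-section binders): (⇐) abc-iut-L5-t8 g12's ★ `V6_R1_orbitTransitivity_holds` (p546164, the lattice algebra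
BY NAME); (⇒) the empty-packet face `not_orbitTransitivity_of_isEmpty`.  So the displayed hypothesis of the v1 kill
`not_finerStableFiltration_of_orbitTransitivity` (★ p544620) survives exactly as `Nonempty I`. [cite: WeilBNT1967, Ch. II §2, Th. 1]
[claim: Mochizuki2012, status: disputed] -/
theorem orbitTransitivity_iff_nonempty : V6_R1_orbitTransitivity p k ↔ Nonempty I := by
  constructor
  · intro hT
    by_contra h
    haveI : IsEmpty I := not_nonempty_iff.mp h
    exact not_orbitTransitivity_of_isEmpty p k hT
  · intro h
    exact V6_R1_orbitTransitivity_holds p k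

/-- **`V6_R1_orbitModuleRigidity p k ⟺ I ≠ ∅`** (V6-section binders): (⇐) abc-iut-L5-t8 g12's ★ `V6_R1_orbitModuleRigidity_holds` (p546164); (⇒) the
empty-packet face `not_orbitModuleRigidity_of_isEmpty`.  So the displayed hypothesis of the face lane's v2 kill (★ p542823
`no_finerSubgroupFiltration_of_orbitModuleRigidity`) survives exactly as `Nonempty I`. [cite: WeilBNT1967, Ch. II §2, Th. 1]
[claim: Mochizuki2012, status: disputed] -/
theorem orbitModuleRigidity_iff_nonempty : V6_R1_orbitModuleRigidity p k ↔ Nonempty I := by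
  constructor
  · intro hR
    by_contra h
    haveI : IsEmpty I := not_nonempty_iff.mp h
    exact not_orbitModuleRigidity_of_isEmpty p k hR
  · intro h
    exact V6_R1_orbitModuleRigidity_holds p k

end Synthesis

end Summit.ABC.IUTFork.Repair.RH.Round4ConstraintV6Transitivity

end
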